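import Summits.ResolutionOfSingularities.ResolutionOfSingularities.Theorems.EquisingularLiftEquisingularLiftNatOneStepJacobianRingEquiv
import Mathlib.RingTheory.MvPolynomial.EulerIdentity
import Mathlib.Algebra.MvPolynomial.Equiv
import HarnessLib

/-!
# [OURS] FIRST-ORDER LINEAR SINGULAR LOCI: the intrinsic criterion over the polynomial base `R = K[u]` produces T-ONESTEP-LINE's strict transforms
# with their regularity certificate (non-isolated side of EL♮(3); cruxes stmt-ResolutionOfSingularities-20038 / -20148 / -15660)

[OURS · leafhand-res-equisingularlift-9 g0, 2026-08-31; cell `pub/decomp-res`] AI-produced, weaker than expert review; NOT a statement of any manuscript;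
nothing here proves resolution of singularities.  DEF-FREE helper; no `sorry`; standard axioms; ZERO named hypotheses.

Seat res-D-pv-013's T-ONESTEP-LINE ✓ `OneStepLine.elNatAt_oneStepLine` (…NatOneStepLinePoints) resolves a hypersurface singular along a coordinate `ℙʳ`
by ONE blow-up along it, provided each chart `f = Φ + Ψ ∈ R[z]` (`R = K[u]` the surviving variables, `Φ ≠ 0` a `z`-form of degree `μ`, `Ψ ∈ (z)^{μ+1}`)
comes with explicit strict transforms `G_l` such that `R[z]/(G_l)` is regular at the primes containing `z̄_l`.  As for points (✓ `FirstOrderPoint.exists_strictTransform`),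
this file derives that hypothesis from an intrinsic FIRST-ORDER CRITERION ALONG THE LINE: split `f = Φ + Ψ₁ + Ψ'` (`Ψ₁` a `z`-form of degree `μ + 1`,
`Ψ' ∈ (z)^{μ+2}`) and ask

  (FO-L) every prime of `R[z]` containing `Φ`, all `∂Φ/∂z_j`, all `∂Φ/∂u_i` and `Ψ₁` contains every `z_j`

— the `u`-DERIVATIVES of the tangent cone enter (the transversal type may degenerate along the line: Whitney umbrella `z₁² − u·z₂²`, where `∂_u Φ = −z₂²`
rescues the criterion in every characteristic, including `2`).  The `u`-derivative on `R[z]` is written def-free as `ρ ∂_{inr i} ρ⁻¹` for Mathlib's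
`ρ = sumAlgEquiv K (Fin (M+1)) (Fin s) : K[z ⊕ u] ≅ K[u][z]`.

* `FirstOrderLine.aeval_smul_eq_pow_mul_aeval`, `pderiv_aeval_update_of_ne`, `pderiv_aeval_update_self`, `exists_aeval_subst_eq_pow_mul`,
  `aeval_update_pderiv_self_mem` — the point-case algebra over a commutative base ring `R`;
* `FirstOrderLine.sumAlgEquiv_symm_C`, `uDeriv_eq_pderiv` (`ρ ∂_{inl j} ρ⁻¹ = ∂/∂z_j`), `uDeriv_C`, `uDeriv_X`, `uDeriv_mul`, `uDeriv_aeval_update`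
  (`∂/∂u_i` commutes with `z_l := 1`) for `ρ = sumAlgEquiv`; `rho_pderiv_mul`, `rho_pderiv_aeval_update` for ANY presentation `ρ : K[ι] ≅ R[z]`;
* ★ `FirstOrderLine.exists_strictTransform` — **(FO-L) ⇒ the per-chart hypothesis of `OneStepLine.elNatAt_oneStepLine`**, for ANY polynomial presentation
  `ρ : K[ι] ≅ R[z]` of the chart ring whose `z_j` are variables and whose other variables differentiate coefficients only: for every `l` a `G` with
  `f(T_l, T_lT_j) = T_l^μ·G` and `R[T]/(G)` regular at every prime containing `T̄_l` (✓ `OneStepRel.isRegularLocalRing_localization_quotient_of_pderiv_ringEquiv`);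
  `sumAlgEquiv_hDz / _hDuX / _hDuC` — the presentation hypotheses for `R = K[u]`, `ρ = sumAlgEquiv K (Fin (M+1)) (Fin s)`.

Honest label: algebra only; the EL♮ wrapper (splitting data `ρ : K[y] ≃ R[z]` of `OneStepLine.elNatAt_oneStepLine`) is NOT assembled here; closes no stub.

References: [Hartshorne1977, I Thm. 5.1, II Ex. 7.12]; [Matsumura1987, Thm. 14.2]; Euler (Mathlib `IsHomogeneous.sum_X_mul_pderiv`).
-/

set_option linter.dupNamespace false -- mandated namespace `Summit.<Summit>.<Problem>` of this single-conjunct summit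

noncomputable section

open MvPolynomial

namespace Summit.ResolutionOfSingularities.ResolutionOfSingularities.Cruxes.EquisingularLiftNat.Sections

namespace FirstOrderLine

/-! ## The point-case algebra over a commutative base ring `R` -/

section Base

variable {R : Type} [CommRing R] {n : ℕ}

/-- `G(c·v) = c^d · G(v)` for a form `G` of degree `d` over any commutative ring. [folklore] -/
theorem aeval_smul_eq_pow_mul_aeval {S : Type} [CommRing S] [Algebra R S] {G : MvPolynomial (Fin n) R} {d : ℕ}
    (hG : G.IsHomogeneous d) (c : S) (v : Fin n → S) :
    aeval (fun j => c * v j) G = c ^ d * aeval v G := by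
  classical
  conv_lhs => rw [G.as_sum]
  conv_rhs => rw [G.as_sum]
  rw [map_sum, map_sum, Finset.mul_sum]
  refine Finset.sum_congr rfl fun m hm => ?_
  have hdeg : (∑ j ∈ m.support, m j) = d := by
    have h := hG (mem_support_iff.mp hm)
    rw [Finsupp.weight_apply, Finsupp.sum] at h
    simpa using h
  rw [aeval_monomial, aeval_monomial, Finsupp.prod, Finsupp.prod]
  simp only [mul_pow, Finset.prod_mul_distrib, Finset.prod_pow_eq_pow_sum, hdeg]
  ring

/-- `∂_j (φ(ẑ)) = (∂_j φ)(ẑ)` for `j ≠ l` (`ẑ = (z with z_l := 1)`). [folklore] -/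
theorem pderiv_aeval_update_of_ne {l j : Fin n} (hjl : j ≠ l) (φ : MvPolynomial (Fin n) R) :
    pderiv j (aeval (Function.update (X : Fin n → MvPolynomial (Fin n) R) l 1) φ) =
      aeval (Function.update (X : Fin n → MvPolynomial (Fin n) R) l 1) (pderiv j φ) := by
  induction φ using MvPolynomial.induction_on with
  | C a => simp [MvPolynomial.algebraMap_eq]
  | add p q hp hq => simp only [map_add, hp, hq]
  | mul_X p i hp =>
    rw [map_mul, aeval_X, pderiv_mul, hp, pderiv_mul, map_add, map_mul, map_mul, aeval_X]
    congr 1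
    by_cases hil : i = l
    · subst hil
      rw [Function.update_self, pderiv_one, pderiv_X_of_ne (Ne.symm hjl), map_zero]
    · rw [Function.update_of_ne hil]
      by_cases hij : i = j
      · subst hij
        rw [pderiv_X_self, map_one]
      · rw [pderiv_X_of_ne hij, map_zero]

/-- `∂_l (φ(ẑ)) = 0`. [folklore] -/
theorem pderiv_aeval_update_self (l : Fin n) (φ : MvPolynomial (Fin n) R) :
    pderiv l (aeval (Function.update (X : Fin n → MvPolynomial (Fin n) R) l 1) φ) = 0 := by
  induction φ using MvPolynomial.induction_on with
  | C a => simp [MvPolynomial.algebraMap_eq]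
  | add p q hp hq => simp only [map_add, hp, hq, add_zero]
  | mul_X p i hp =>
    rw [map_mul, aeval_X, pderiv_mul, hp, zero_mul, zero_add]
    by_cases hil : i = l
    · subst hil
      rw [Function.update_self, pderiv_one, mul_zero]
    · rw [Function.update_of_ne hil, pderiv_X_of_ne hil, mul_zero]

/-- `Ψ(T_l, T_l·T_j) ∈ T_l^k · R[T]` for `Ψ ∈ (z)^k`. [folklore] -/
theorem exists_aeval_subst_eq_pow_mul (l : Fin n) {Ψ : MvPolynomial (Fin n) R} {k : ℕ}
    (hΨ : Ψ ∈ Ideal.span (Set.range (X : Fin n → MvPolynomial (Fin n) R)) ^ k) :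
    ∃ Q : MvPolynomial (Fin n) R,
      aeval (fun j => X l * Function.update (X : Fin n → MvPolynomial (Fin n) R) l 1 j) Ψ = X l ^ k * Q := by
  set s : MvPolynomial (Fin n) R →ₐ[R] MvPolynomial (Fin n) R :=
    aeval (fun j => X l * Function.update (X : Fin n → MvPolynomial (Fin n) R) l 1 j) with hs
  have hle : Ideal.map s.toRingHom (Ideal.span (Set.range (X : Fin n → MvPolynomial (Fin n) R))) ≤ Ideal.span {(X l : MvPolynomial (Fin n) R)} := by
    rw [Ideal.map_span, Ideal.span_le]
    rintro _ ⟨_, ⟨j, rfl⟩, rfl⟩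
    simp only [AlgHom.toRingHom_eq_coe, RingHom.coe_coe, hs, aeval_X, SetLike.mem_coe]
    exact Ideal.mem_span_singleton.mpr (dvd_mul_right _ _)
  have hmem : s Ψ ∈ Ideal.span {(X l : MvPolynomial (Fin n) R)} ^ k := by
    have h := Ideal.mem_map_of_mem s.toRingHom hΨ
    rw [Ideal.map_pow] at h
    exact Ideal.pow_right_mono hle k h
  rw [Ideal.span_singleton_pow, Ideal.mem_span_singleton] at hmem
  obtain ⟨Q, hQ⟩ := hmem
  exact ⟨Q, hQ⟩

/-- EULER: if `Φ(ẑ)` and the `(∂_jΦ)(ẑ)`, `j ≠ l`, lie in an ideal, so does `(∂_lΦ)(ẑ)`. [folklore] -/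
theorem aeval_update_pderiv_self_mem (l : Fin n) {Φ : MvPolynomial (Fin n) R} {μ : ℕ} (hΦ : Φ.IsHomogeneous μ)
    (P : Ideal (MvPolynomial (Fin n) R))
    (h0 : aeval (Function.update (X : Fin n → MvPolynomial (Fin n) R) l 1) Φ ∈ P)
    (hj : ∀ j, j ≠ l → aeval (Function.update (X : Fin n → MvPolynomial (Fin n) R) l 1) (pderiv j Φ) ∈ P) :
    aeval (Function.update (X : Fin n → MvPolynomial (Fin n) R) l 1) (pderiv l Φ) ∈ P := by
  have h := congrArg (aeval (Function.update (X : Fin n → MvPolynomial (Fin n) R) l 1)) hΦ.sum_X_mul_pderiv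
  rw [map_sum, map_nsmul, ← Finset.add_sum_erase _ _ (Finset.mem_univ l), map_mul, aeval_X, Function.update_self, one_mul] at h
  have h' : aeval (Function.update (X : Fin n → MvPolynomial (Fin n) R) l 1) (pderiv l Φ) =
      μ • aeval (Function.update (X : Fin n → MvPolynomial (Fin n) R) l 1) Φ -
        ∑ i ∈ Finset.univ.erase l, aeval (Function.update (X : Fin n → MvPolynomial (Fin n) R) l 1) (X i * pderiv i Φ) :=
    eq_sub_of_add_eq h
  rw [h']
  refine P.sub_mem ?_ (P.sum_mem fun i hi => ?_)
  · rw [nsmul_eq_mul]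
    exact P.mul_mem_left _ h0
  · rw [map_mul]
    exact P.mul_mem_left _ (hj i (Finset.ne_of_mem_erase hi))

end Base

/-! ## The `u`-derivatives on `K[u][z]` through `ρ = sumAlgEquiv : K[z ⊕ u] ≅ K[u][z]` -/

section UDeriv

variable {K : Type} [Field K] {M s : ℕ}

/-- `ρ⁻¹ (C r) = r(u)` read in `K[z ⊕ u]`: `rename inr r`. [folklore] -/
theorem sumAlgEquiv_symm_C (r : (MvPolynomial (Fin s) K)) : (sumAlgEquiv K (Fin (M + 1)) (Fin s)).symm (C r) = rename Sum.inr r := by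
  induction r using MvPolynomial.induction_on with
  | C a => rw [sumAlgEquiv_symm_C_C, rename_C]
  | add p q hp hq => rw [map_add, map_add, hp, hq, map_add]
  | mul_X p c hp => rw [map_mul, map_mul, hp, sumAlgEquiv_symm_C_X, map_mul, rename_X]

/-- **`ρ ∂_{inl j} ρ⁻¹ = ∂/∂z_j`** on `K[u][z]`. [folklore] -/
theorem uDeriv_eq_pderiv (j : Fin (M + 1)) (q : MvPolynomial (Fin (M + 1)) (MvPolynomial (Fin s) K)) :
    (sumAlgEquiv K (Fin (M + 1)) (Fin s)) (pderiv (Sum.inl j) ((sumAlgEquiv K (Fin (M + 1)) (Fin s)).symm q)) = pderiv j q := by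
  classical
  induction q using MvPolynomial.induction_on with
  | C r =>
    rw [sumAlgEquiv_symm_C, pderiv_eq_zero_of_notMem_vars, map_zero, pderiv_C]
    intro hmem
    obtain ⟨i, -, hi⟩ := Finset.mem_image.mp (vars_rename _ _ hmem)
    exact Sum.inr_ne_inl hi
  | add p q hp hq => rw [map_add, map_add, map_add, hp, hq, map_add]
  | mul_X p i hp =>
    rw [map_mul, sumAlgEquiv_symm_X, pderiv_mul, map_add, map_mul, map_mul, hp, AlgEquiv.apply_symm_apply, pderiv_X,
      pderiv_mul, pderiv_X]
    by_cases hij : j = i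
    · subst hij
      simp
    · have h1 : (Sum.inl j : Fin (M + 1) ⊕ Fin s) ≠ Sum.inl i := fun h => hij (Sum.inl_injective h)
      simp [Pi.single_eq_of_ne' h1, Pi.single_eq_of_ne' hij]

/-- `ρ ∂_{inr i} ρ⁻¹ (C r) = C (∂r/∂u_i)`. [folklore] -/
theorem uDeriv_C (i : Fin s) (r : (MvPolynomial (Fin s) K)) : (sumAlgEquiv K (Fin (M + 1)) (Fin s)) (pderiv (Sum.inr i) ((sumAlgEquiv K (Fin (M + 1)) (Fin s)).symm (C r))) = C (pderiv i r) := by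
  rw [sumAlgEquiv_symm_C, pderiv_rename Sum.inr_injective, ← sumAlgEquiv_symm_C, AlgEquiv.apply_symm_apply]

/-- `ρ ∂_{inr i} ρ⁻¹ (z_j) = 0`. [folklore] -/
theorem uDeriv_X (i : Fin s) (j : Fin (M + 1)) : (sumAlgEquiv K (Fin (M + 1)) (Fin s)) (pderiv (Sum.inr i) ((sumAlgEquiv K (Fin (M + 1)) (Fin s)).symm (X j : MvPolynomial (Fin (M + 1)) (MvPolynomial (Fin s) K)))) = 0 := by
  rw [sumAlgEquiv_symm_X, pderiv_X_of_ne (Sum.inl_ne_inr), map_zero]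

/-- Leibniz for `ρ ∂_{inr i} ρ⁻¹`. [folklore] -/
theorem uDeriv_mul (i : Fin s) (p q : MvPolynomial (Fin (M + 1)) (MvPolynomial (Fin s) K)) :
    (sumAlgEquiv K (Fin (M + 1)) (Fin s)) (pderiv (Sum.inr i) ((sumAlgEquiv K (Fin (M + 1)) (Fin s)).symm (p * q))) =
      (sumAlgEquiv K (Fin (M + 1)) (Fin s)) (pderiv (Sum.inr i) ((sumAlgEquiv K (Fin (M + 1)) (Fin s)).symm p)) * q + p * (sumAlgEquiv K (Fin (M + 1)) (Fin s)) (pderiv (Sum.inr i) ((sumAlgEquiv K (Fin (M + 1)) (Fin s)).symm q)) := by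
  rw [map_mul, pderiv_mul, map_add, map_mul, map_mul, AlgEquiv.apply_symm_apply, AlgEquiv.apply_symm_apply]

/-- **`∂/∂u_i` commutes with `z_l := 1`**: `ρ∂_{inr i}ρ⁻¹ (Φ(ẑ)) = (ρ∂_{inr i}ρ⁻¹ Φ)(ẑ)`. [folklore] -/
theorem uDeriv_aeval_update (i : Fin s) (l : Fin (M + 1)) (Φ : MvPolynomial (Fin (M + 1)) (MvPolynomial (Fin s) K)) :
    (sumAlgEquiv K (Fin (M + 1)) (Fin s)) (pderiv (Sum.inr i) ((sumAlgEquiv K (Fin (M + 1)) (Fin s)).symm (aeval (Function.update (X : Fin (M + 1) → MvPolynomial (Fin (M + 1)) (MvPolynomial (Fin s) K)) l 1) Φ))) =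
      aeval (Function.update (X : Fin (M + 1) → MvPolynomial (Fin (M + 1)) (MvPolynomial (Fin s) K)) l 1) ((sumAlgEquiv K (Fin (M + 1)) (Fin s)) (pderiv (Sum.inr i) ((sumAlgEquiv K (Fin (M + 1)) (Fin s)).symm Φ))) := by
  induction Φ using MvPolynomial.induction_on with
  | C r => rw [aeval_C, MvPolynomial.algebraMap_eq, uDeriv_C, aeval_C, MvPolynomial.algebraMap_eq]
  | add p q hp hq => simp only [map_add, hp, hq]
  | mul_X p j hp =>
    rw [map_mul, aeval_X, uDeriv_mul, hp, uDeriv_mul, uDeriv_X, mul_zero, add_zero, map_mul, aeval_X]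
    have h0 : (sumAlgEquiv K (Fin (M + 1)) (Fin s)) (pderiv (Sum.inr i) ((sumAlgEquiv K (Fin (M + 1)) (Fin s)).symm (Function.update (X : Fin (M + 1) → MvPolynomial (Fin (M + 1)) (MvPolynomial (Fin s) K)) l 1 j))) = 0 := by
      by_cases hjl : j = l
      · subst hjl
        rw [Function.update_self, map_one, pderiv_one, map_zero]
      · rw [Function.update_of_ne hjl, uDeriv_X]
    rw [h0, mul_zero, add_zero]

end UDeriv

/-! ## The same calculus for ANY polynomial presentation `ρ : K[ι] ≅ R[z]` of the chart ring -/

section AnyBase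

variable {K : Type} [Field K] {ι : Type} {R : Type} [CommRing R] {M : ℕ}
  (ρ : MvPolynomial ι K ≃+* MvPolynomial (Fin (M + 1)) R)

/-- Leibniz for `ρ ∂_v ρ⁻¹`. [folklore] -/
theorem rho_pderiv_mul (v : ι) (p q : MvPolynomial (Fin (M + 1)) R) :
    ρ (pderiv v (ρ.symm (p * q))) = ρ (pderiv v (ρ.symm p)) * q + p * ρ (pderiv v (ρ.symm q)) := by
  rw [map_mul, pderiv_mul, map_add, map_mul, map_mul, RingEquiv.apply_symm_apply, RingEquiv.apply_symm_apply]

/-- **A derivation `ρ ∂_v ρ⁻¹` killing the `z_j` and preserving the coefficients commutes with `z_l := 1`.** [folklore] -/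
theorem rho_pderiv_aeval_update (v : ι) (hX : ∀ j : Fin (M + 1), ρ (pderiv v (ρ.symm (X j))) = 0)
    (hC : ∀ r : R, ∃ r' : R, ρ (pderiv v (ρ.symm (C r))) = C r') (l : Fin (M + 1)) (Φ : MvPolynomial (Fin (M + 1)) R) :
    ρ (pderiv v (ρ.symm (aeval (Function.update (X : Fin (M + 1) → MvPolynomial (Fin (M + 1)) R) l 1) Φ))) =
      aeval (Function.update (X : Fin (M + 1) → MvPolynomial (Fin (M + 1)) R) l 1) (ρ (pderiv v (ρ.symm Φ))) := by
  induction Φ using MvPolynomial.induction_on with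
  | C r =>
    obtain ⟨r', hr'⟩ := hC r
    rw [aeval_C, MvPolynomial.algebraMap_eq, hr', aeval_C, MvPolynomial.algebraMap_eq]
  | add p q hp hq => simp only [map_add, hp, hq]
  | mul_X p j hp =>
    rw [map_mul, aeval_X, rho_pderiv_mul, hp, rho_pderiv_mul, hX, mul_zero, add_zero, map_mul, aeval_X]
    have h0 : ρ (pderiv v (ρ.symm (Function.update (X : Fin (M + 1) → MvPolynomial (Fin (M + 1)) R) l 1 j))) = 0 := by
      by_cases hjl : j = l
      · subst hjl
        rw [Function.update_self, map_one, pderiv_one, map_zero]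
      · rw [Function.update_of_ne hjl, hX]
    rw [h0, mul_zero, add_zero]

/-! ## ★ The first-order criterion along the line produces the strict transforms with their regularity certificate -/

/-- ★ **(FO-L) ⇒ T-ONESTEP-LINE's per-chart hypothesis — any polynomial presentation of the base.**  `ρ : K[ι] ≅ R[z₀,…,z_M]` a ring isomorphism
(`ι` finite) under which the `z_j` are variables (`ρ∂_{ι_z j}ρ⁻¹ = ∂/∂z_j`) and the remaining variables `v ∉ range ι_z` differentiate the COEFFICIENTS only
(`ρ∂_vρ⁻¹ z_j = 0`, `ρ∂_vρ⁻¹ (C r) = C r'`) — e.g. `R = K[u]`, `ρ = sumAlgEquiv` (`sumAlgEquiv_hDz`, `sumAlgEquiv_hDuX`, `sumAlgEquiv_hDuC` below).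
`f = Φ + (Ψ₁ + Ψ')` with `Φ` a `z`-form of degree `μ`, `Ψ₁` a `z`-form of degree `μ + 1`, `Ψ' ∈ (z)^{μ+2}`; (FO-L) every prime of `R[z]` containing `Φ`,
ALL its partials `ρ∂_vρ⁻¹Φ` (`z`- and `u`-directions) and `Ψ₁` contains all `z_j`.  Then for every chart `l` there is `G` with `f(T_l, T_lT_j) = T_l^μ·G` and
`R[T]/(G)` regular at every prime containing `T̄_l` (`G = Φ(T̂) + T_l(Ψ₁(T̂) + T_lQ)`; at a prime `P ∋ T_l, G` containing all `ρ∂_vρ⁻¹G` one finds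
`Φ(T̂), (∂_{z_j}Φ)(T̂)` (Euler for `j = l`), `(ρ∂_vρ⁻¹Φ)(T̂), Ψ₁(T̂) ∈ P`, and (FO-L) for `(z ↦ T̂)⁻¹P` gives `1 ∈ P`;
✓ `OneStepRel.isRegularLocalRing_localization_quotient_of_pderiv_ringEquiv`). [cite: Hartshorne1977, I Thm. 5.1] [cite: Matsumura1987, Thm. 14.2] -/
theorem exists_strictTransform [Finite ι] (ιz : Fin (M + 1) → ι)
    (hDz : ∀ (j : Fin (M + 1)) (q : MvPolynomial (Fin (M + 1)) R), ρ (pderiv (ιz j) (ρ.symm q)) = pderiv j q)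
    (hDuX : ∀ v, v ∉ Set.range ιz → ∀ j : Fin (M + 1), ρ (pderiv v (ρ.symm (X j))) = 0)
    (hDuC : ∀ v, v ∉ Set.range ιz → ∀ r : R, ∃ r' : R, ρ (pderiv v (ρ.symm (C r))) = C r')
    (Φ Ψ₁ Ψ' : MvPolynomial (Fin (M + 1)) R) {μ : ℕ} (hΦ : Φ.IsHomogeneous μ) (hΨ₁ : Ψ₁.IsHomogeneous (μ + 1))
    (hΨ' : Ψ' ∈ Ideal.span (Set.range (X : Fin (M + 1) → MvPolynomial (Fin (M + 1)) R)) ^ (μ + 2))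
    (hcrit : ∀ P : Ideal (MvPolynomial (Fin (M + 1)) R), P.IsPrime → Φ ∈ P → (∀ v : ι, ρ (pderiv v (ρ.symm Φ)) ∈ P) → Ψ₁ ∈ P →
      ∀ j, (X j : MvPolynomial (Fin (M + 1)) R) ∈ P)
    (l : Fin (M + 1)) :
    ∃ G : MvPolynomial (Fin (M + 1)) R,
      aeval (fun j => X l * Function.update (X : Fin (M + 1) → MvPolynomial (Fin (M + 1)) R) l 1 j) (Φ + (Ψ₁ + Ψ')) = X l ^ μ * G ∧
      ∀ (P : Ideal (MvPolynomial (Fin (M + 1)) R ⧸ Ideal.span {G})) [P.IsPrime],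
        Ideal.Quotient.mk (Ideal.span {G}) (X l) ∈ P → IsRegularLocalRing (Localization.AtPrime P) := by
  classical
  obtain ⟨Q, hQ⟩ := exists_aeval_subst_eq_pow_mul l hΨ'
  set u : Fin (M + 1) → MvPolynomial (Fin (M + 1)) R := Function.update (X : Fin (M + 1) → MvPolynomial (Fin (M + 1)) R) l 1 with hu
  set G : MvPolynomial (Fin (M + 1)) R := aeval u Φ + X l * (aeval u Ψ₁ + X l * Q) with hGdef
  refine ⟨G, ?_, ?_⟩
  · rw [map_add, map_add, aeval_smul_eq_pow_mul_aeval hΦ (X l) _, aeval_smul_eq_pow_mul_aeval hΨ₁ (X l) _, hQ, hGdef]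
    ring
  · intro Pbar hPbar hXl
    -- the prime of `R[z]` below `Pbar`
    set P : Ideal (MvPolynomial (Fin (M + 1)) R) := Pbar.comap (Ideal.Quotient.mk (Ideal.span {G})) with hP
    haveI : P.IsPrime := Ideal.comap_isPrime _ Pbar
    have hmemP : ∀ q, q ∈ P ↔ Ideal.Quotient.mk (Ideal.span {G}) q ∈ Pbar := fun q => by rw [hP, Ideal.mem_comap]
    have hXlP : (X l : MvPolynomial (Fin (M + 1)) R) ∈ P := (hmemP _).mpr hXl
    have hGP : G ∈ P := (hmemP _).mpr (by rw [Ideal.Quotient.eq_zero_iff_mem.mpr (Ideal.mem_span_singleton_self G)]; exact zero_mem _)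
    -- if every partial lay in `P`, …
    by_contra hreg
    have hall : ∀ v : ι, ρ (pderiv v (ρ.symm G)) ∈ P := by
      intro v
      by_contra hv
      exact hreg (OneStepRel.isRegularLocalRing_localization_quotient_of_pderiv_ringEquiv ρ Pbar v (fun h => hv ((hmemP _).mpr h)))
    have hallz : ∀ j : Fin (M + 1), pderiv j G ∈ P := fun j => by
      have h := hall (ιz j)
      rwa [hDz] at h
    -- `Φ(T̂) ∈ P`
    have hΦu : aeval u Φ ∈ P := by
      have h : aeval u Φ = G - X l * (aeval u Ψ₁ + X l * Q) := by rw [hGdef]; ring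
      rw [h]
      exact P.sub_mem hGP (P.mul_mem_right _ hXlP)
    -- the `z`-partials, `j ≠ l`
    have hju : ∀ j, j ≠ l → aeval u (pderiv j Φ) ∈ P := by
      intro j hjl
      have h := hallz j
      rw [hGdef, map_add, pderiv_aeval_update_of_ne hjl, pderiv_mul, pderiv_X_of_ne (Ne.symm hjl), zero_mul, zero_add] at h
      have h' : aeval u (pderiv j Φ) = (aeval u (pderiv j Φ) + X l * pderiv j (aeval u Ψ₁ + X l * Q)) -
          X l * pderiv j (aeval u Ψ₁ + X l * Q) := by ring
      rw [h']
      exact P.sub_mem h (P.mul_mem_right _ hXlP)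
    -- `Ψ₁(T̂) ∈ P` (the partial `j = l`)
    have hΨu : aeval u Ψ₁ ∈ P := by
      have h := hallz l
      rw [hGdef, map_add, pderiv_aeval_update_self l, zero_add, pderiv_mul, pderiv_X_self, one_mul] at h
      have h' : aeval u Ψ₁ = (aeval u Ψ₁ + X l * Q + X l * pderiv l (aeval u Ψ₁ + X l * Q)) -
          X l * (Q + pderiv l (aeval u Ψ₁ + X l * Q)) := by ring
      rw [h']
      exact P.sub_mem h (P.mul_mem_right _ hXlP)
    -- Euler: `j = l` too
    have hlu : aeval u (pderiv l Φ) ∈ P := aeval_update_pderiv_self_mem l hΦ P hΦu hju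
    have hallz' : ∀ j, aeval u (pderiv j Φ) ∈ P := fun j => by
      by_cases hjl : j = l
      · subst hjl; exact hlu
      · exact hju j hjl
    -- all `ρ`-partials of `Φ`, evaluated at `T̂`, lie in `P`
    have hallv : ∀ v : ι, aeval u (ρ (pderiv v (ρ.symm Φ))) ∈ P := by
      intro v
      by_cases hv : v ∈ Set.range ιz
      · obtain ⟨j, rfl⟩ := hv
        rw [hDz]
        exact hallz' j
      · have h := hall v
        rw [hGdef, map_add, map_add, map_add, rho_pderiv_aeval_update ρ v (hDuX v hv) (hDuC v hv), rho_pderiv_mul, hDuX v hv l, zero_mul,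
          zero_add] at h
        have h' : aeval u (ρ (pderiv v (ρ.symm Φ))) =
            (aeval u (ρ (pderiv v (ρ.symm Φ))) + X l * ρ (pderiv v (ρ.symm (aeval u Ψ₁ + X l * Q)))) -
              X l * ρ (pderiv v (ρ.symm (aeval u Ψ₁ + X l * Q))) := by ring
        rw [h']
        exact P.sub_mem h (P.mul_mem_right _ hXlP)
    -- pull back along `z ↦ T̂`
    set Q' : Ideal (MvPolynomial (Fin (M + 1)) R) := P.comap (aeval u).toRingHom with hQ'
    haveI : Q'.IsPrime := Ideal.comap_isPrime _ P
    have hmem : ∀ q, q ∈ Q' ↔ aeval u q ∈ P := fun q => by rw [hQ', Ideal.mem_comap]; rfl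
    have hXQ : (X l : MvPolynomial (Fin (M + 1)) R) ∈ Q' :=
      hcrit Q' inferInstance ((hmem Φ).mpr hΦu) (fun v => (hmem _).mpr (hallv v)) ((hmem Ψ₁).mpr hΨu) l
    rw [hmem, aeval_X, hu, Function.update_self] at hXQ
    exact (inferInstance : P.IsPrime).ne_top ((Ideal.eq_top_iff_one P).mpr hXQ)

end AnyBase

/-! ## The instance `R = K[u]`, `ρ = sumAlgEquiv` -/

section SumAlgEquiv

variable {K : Type} [Field K] {M s : ℕ}

/-- `hDz` for `sumAlgEquiv`: the `z`-directions are the `inl` variables. [folklore] -/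
theorem sumAlgEquiv_hDz (j : Fin (M + 1)) (q : MvPolynomial (Fin (M + 1)) (MvPolynomial (Fin s) K)) :
    (sumAlgEquiv K (Fin (M + 1)) (Fin s)).toRingEquiv (pderiv (Sum.inl j) ((sumAlgEquiv K (Fin (M + 1)) (Fin s)).toRingEquiv.symm q)) =
      pderiv j q :=
  uDeriv_eq_pderiv j q

/-- `hDuX` for `sumAlgEquiv`: the `inr` (= `u`) directions kill the `z_j`. [folklore] -/
theorem sumAlgEquiv_hDuX (v : Fin (M + 1) ⊕ Fin s) (hv : v ∉ Set.range (Sum.inl : Fin (M + 1) → Fin (M + 1) ⊕ Fin s)) (j : Fin (M + 1)) :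
    (sumAlgEquiv K (Fin (M + 1)) (Fin s)).toRingEquiv (pderiv v ((sumAlgEquiv K (Fin (M + 1)) (Fin s)).toRingEquiv.symm
      (X j : MvPolynomial (Fin (M + 1)) (MvPolynomial (Fin s) K)))) = 0 := by
  obtain ⟨j', rfl⟩ | ⟨i, rfl⟩ := (Sum.exists (p := fun w => w = v)).mp ⟨v, rfl⟩
  · exact absurd ⟨j', rfl⟩ hv
  · exact uDeriv_X i j

/-- `hDuC` for `sumAlgEquiv`: the `u`-directions differentiate the coefficients. [folklore] -/
theorem sumAlgEquiv_hDuC (v : Fin (M + 1) ⊕ Fin s) (hv : v ∉ Set.range (Sum.inl : Fin (M + 1) → Fin (M + 1) ⊕ Fin s))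
    (r : MvPolynomial (Fin s) K) :
    ∃ r' : MvPolynomial (Fin s) K, (sumAlgEquiv K (Fin (M + 1)) (Fin s)).toRingEquiv
      (pderiv v ((sumAlgEquiv K (Fin (M + 1)) (Fin s)).toRingEquiv.symm (C r))) = C r' := by
  obtain ⟨j', rfl⟩ | ⟨i, rfl⟩ := (Sum.exists (p := fun w => w = v)).mp ⟨v, rfl⟩
  · exact absurd ⟨j', rfl⟩ hv
  · exact ⟨pderiv i r, uDeriv_C i r⟩

end SumAlgEquiv

end FirstOrderLine

end Summit.ResolutionOfSingularities.ResolutionOfSingularities.Cruxes.EquisingularLiftNat.Sections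

end
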